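import Mathlib.Probability.ProbabilityMassFunction.Constructions
import Mathlib.MeasureTheory.Constructions.Pi
import Mathlib.MeasureTheory.Measure.Prod
import HarnessLib

/-!
# Finite product laws as `PMF`s and their bridge to product measures

Topic `Probability/Distributions`. Mathlib's probability mass functions (`PMF`) have `bind`/`map`
but no product constructions, while independence, Chebyshev's inequality and the like live on the
measure side (`Measure.prod`, `Measure.pi`, `iIndepFun_pi`). Discrete reductions (sampling /
estimation arguments over finite sample spaces) are most conveniently SPECIFIED with `PMF`s (exact
mass formulas, reindexing by `Fintype.prod_equiv`) and ANALYSED with measures. This file provides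
the two product laws and the dictionary:

* `prodLaw p r` — the law of an independent pair, `(p ⊗ r)(a, b) = p a · r b` (`prodLaw_apply`),
  with marginals `prodLaw_map_fst`, `prodLaw_map_snd`;
* `piLaw P` — the law of an independent family `(Xᵢ)_{i ∈ ι}`, `ι` finite, `Xᵢ ∼ P i` on finite
  types: `(⨂ᵢ P i)(f) = ∏ᵢ P i (f i)` (`piLaw_apply`; an honest `PMF.ofFintype`, total mass `1` by
  `Finset.prod_univ_sum`);
* `toMeasure_prodLaw : (prodLaw p r).toMeasure = p.toMeasure.prod r.toMeasure` and
  `toMeasure_piLaw : (piLaw P).toMeasure = Measure.pi (fun i => (P i).toMeasure)` on countable types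
  with measurable singletons (two measures on a countable type agreeing on singletons are equal,
  `Measure.ext_of_singleton`; `Measure.prod_prod`, `Measure.pi_pi` on singleton boxes), and the
  `toOuterMeasure` forms `toOuterMeasure_prodLaw_apply`, `toOuterMeasure_piLaw_apply` (no measurable
  structure in the statement's objects beyond the instances used to form the product measure).

(The tree also has the homogeneous special case `Literature.Computability.Cryptography.iidPMF μ`
on `ι → α`, `SparseLPN.lean`, `= piLaw fun _ => μ` by `piLaw_apply`; and the `Fin`-recursive
`Literature.Computability.Cryptography.LWE.iidPMF p m`, `LWE.lean`, with the same masses by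
`iidPMF_apply_holds`.)

## References

* W. Feller, *An Introduction to Probability Theory and its Applications* I, 3rd ed., Wiley 1968,
  §V.4 and §IX.1 (product spaces of independent trials; mass of a sample point is the product).
  Standard; fully proved here. [folklore]
* Mathlib: `MeasureTheory.Measure.pi_pi`, `MeasureTheory.Measure.prod_prod`,
  `MeasureTheory.Measure.ext_of_singleton`, `PMF.toMeasure_apply_singleton`.
-/

noncomputable section

namespace Literature.Probability.Distributions

open _root_.MeasureTheory
open scoped ENNReal

/-! ### The law of an independent pair -/

section Prod

variable {α β : Type*}

/-- The product law `p ⊗ r` of an independent pair: draw `a ← p`, `b ← r`, return `(a, b)`.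
[folklore] -/
def prodLaw (p : PMF α) (r : PMF β) : PMF (α × β) :=
  p.bind fun a => r.map (Prod.mk a)

/-- Mass formula: `(p ⊗ r)(a, b) = p a · r b`. [folklore] -/
@[simp] theorem prodLaw_apply (p : PMF α) (r : PMF β) (a : α) (b : β) :
    prodLaw p r (a, b) = p a * r b := by
  rw [prodLaw, PMF.bind_apply, tsum_eq_single a]
  · congr 1
    rw [PMF.map_apply, tsum_eq_single b]
    · rw [if_pos rfl]
    · intro b' hb'
      rw [if_neg]
      intro h
      exact hb' (Prod.ext_iff.1 h).2.symm
  · intro a' ha'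
    rw [PMF.map_apply, ENNReal.tsum_eq_zero.2, mul_zero]
    intro b'
    rw [if_neg]
    intro h
    exact ha' (Prod.ext_iff.1 h).1.symm

/-- The first marginal of `p ⊗ r` is `p`. [folklore] -/
theorem prodLaw_map_fst (p : PMF α) (r : PMF β) : (prodLaw p r).map Prod.fst = p := by
  rw [prodLaw, PMF.map_bind]
  have h : ∀ a : α, (r.map (Prod.mk a)).map Prod.fst = PMF.pure a := fun a => by
    rw [PMF.map_comp]
    exact PMF.map_const _ _
  simp_rw [h]
  exact PMF.bind_pure _

/-- The second marginal of `p ⊗ r` is `r`. [folklore] -/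
theorem prodLaw_map_snd (p : PMF α) (r : PMF β) : (prodLaw p r).map Prod.snd = r := by
  rw [prodLaw, PMF.map_bind]
  have h : ∀ a : α, (r.map (Prod.mk a)).map Prod.snd = r := fun a => by
    rw [PMF.map_comp]
    exact PMF.map_id r
  simp_rw [h]
  exact PMF.bind_const _ _

end Prod

/-! ### The law of a finite independent family -/

section Pi

variable {ι : Type*} {κ : ι → Type*} [Fintype ι] [DecidableEq ι] [∀ i, Fintype (κ i)]

/-- The product law `⨂ᵢ P i` of an independent family indexed by a finite `ι`, each `P i` a law on a
finite type: mass `∏ᵢ P i (f i)` at `f`. [folklore] -/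
def piLaw (P : ∀ i, PMF (κ i)) : PMF (∀ i, κ i) :=
  PMF.ofFintype (fun f => ∏ i, P i (f i)) (by
    classical
    rw [← Fintype.piFinset_univ, ← Finset.prod_univ_sum (fun _ => Finset.univ) fun i a => P i a]
    have h1 : ∀ i, ∑ a, P i a = 1 := fun i => by
      rw [← tsum_fintype (L := SummationFilter.unconditional _)]
      exact (P i).tsum_coe
    simp [h1])

/-- Mass formula: `(⨂ᵢ P i)(f) = ∏ᵢ P i (f i)`. [folklore] -/
@[simp] theorem piLaw_apply (P : ∀ i, PMF (κ i)) (f : ∀ i, κ i) : piLaw P f = ∏ i, P i (f i) :=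
  PMF.ofFintype_apply _ _

end Pi

/-! ### Bridge to product measures -/

section MeasureProd

variable {α β : Type*} [MeasurableSpace α] [MeasurableSpace β] [MeasurableSingletonClass α]
  [MeasurableSingletonClass β] [Countable α] [Countable β]

/-- **The measure of `p ⊗ r` is the product measure.** [folklore] -/
theorem toMeasure_prodLaw (p : PMF α) (r : PMF β) :
    (prodLaw p r).toMeasure = p.toMeasure.prod r.toMeasure := by
  refine Measure.ext_of_singleton fun x => ?_
  obtain ⟨a, b⟩ := x
  rw [PMF.toMeasure_apply_singleton _ _ (measurableSet_singleton _), prodLaw_apply,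
    ← Set.singleton_prod_singleton, Measure.prod_prod,
    PMF.toMeasure_apply_singleton _ _ (measurableSet_singleton _),
    PMF.toMeasure_apply_singleton _ _ (measurableSet_singleton _)]

/-- `toOuterMeasure` form: the mass `p ⊗ r` gives to ANY set is its product measure. [folklore] -/
theorem toOuterMeasure_prodLaw_apply (p : PMF α) (r : PMF β) (s : Set (α × β)) :
    (prodLaw p r).toOuterMeasure s = p.toMeasure.prod r.toMeasure s := by
  rw [← toMeasure_prodLaw, PMF.toMeasure_apply_eq_toOuterMeasure]

end MeasureProd

section MeasurePi

variable {ι : Type*} {κ : ι → Type*} [Fintype ι] [DecidableEq ι] [∀ i, Fintype (κ i)]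
  [∀ i, MeasurableSpace (κ i)]
  [∀ i, MeasurableSingletonClass (κ i)]

/-- **The measure of `⨂ᵢ P i` is the product measure `Measure.pi`.** [folklore] -/
theorem toMeasure_piLaw (P : ∀ i, PMF (κ i)) :
    (piLaw P).toMeasure = Measure.pi fun i => (P i).toMeasure := by
  refine Measure.ext_of_singleton fun f => ?_
  rw [PMF.toMeasure_apply_singleton _ _ (measurableSet_singleton _), piLaw_apply,
    ← Set.univ_pi_singleton f, Measure.pi_pi]
  exact Finset.prod_congr rfl fun i _ =>
    (PMF.toMeasure_apply_singleton _ _ (measurableSet_singleton _)).symm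

/-- `toOuterMeasure` form: the mass `⨂ᵢ P i` gives to ANY set is its `Measure.pi` measure. [folklore] -/
theorem toOuterMeasure_piLaw_apply (P : ∀ i, PMF (κ i)) (s : Set (∀ i, κ i)) :
    (piLaw P).toOuterMeasure s = Measure.pi (fun i => (P i).toMeasure) s := by
  rw [← toMeasure_piLaw, PMF.toMeasure_apply_eq_toOuterMeasure]

end MeasurePi

end Literature.Probability.Distributions

end
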